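import Summits.AtomisticToContinuum.Crystallization.Theorems.ChartedZeroExcessLayeredLatticeLiouvilleZZZYRCXRVA

/-!
# ChartedZeroExcessLayeredLatticeLiouville · ZZZYRCXRV — SUB-WINDOW RUNS OF THE OUT KERNEL AND THE UNION ASSEMBLY (half-word units)
(decomp-a2c lens-2 g101; binder stmt-AtomisticToContinuum-26636, line (D) kernel production; critic r1907 (B1) «total half-word decomposition»,
(B3) lemma (L2); consumer = hand-1 g56's unit files `…TWHU<u>Out{M,P}<Δm>.lean`, which certify
`slabAccO u 605 610 605 P9 E lo hi tree0 chords = some table ∧ countWinsO u 605 610 605 GB lo hi ym = n ∧ …` on the SUB-WINDOW `[605, 610]`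
(= `[600 + H₀, 600 + 2H₀]`, the upper half-word `u`) for one far layer `ym` at a time, inner (`Δm = 0 … 5`) and outer (`Δm ≥ 6`) alike.)

The out kernel of record (RCXRK `slabAccO`) is sound for EVERY letter assignment admissible for its letter window (RCXRS `slabAccO_sound`): a run
with a SMALLER window only frees letters, so its certificate serves every full word containing the sub-window word as a factor.  This file turns
that remark into the assembly hand-1's half-word units need:

* §13 `subWord` (decided factor test) and ★ `admO_sub`: admissible for `[wlo, whi]` with `win` ⇒ admissible for any sub-window with its factor;
* §14 ★ `KernelSlabSoundOn H₀ R Agree yms …` — the PARTIAL windowed contract on the far layers `yms` (shifted codes `600 + m`) under an arbitrary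
  agreement predicate `Agree` on letter sequences (lens-2 RCZU currency: `IsCenterBased`, `PiecesWithin`, guarded piece clause, `thetaR0G/thetaN0G`);
  `kernelSlabSoundOn_mono` (weaker agreement ⇒ stronger contract), ★ `kernelSlabSoundOn_append` (union of two parts on DISJOINT far-layer lists:
  data concatenated, tables added), ★ `kernelSlabSoundF_of_on` (a part covering every layer within `M` of the centre, `hi < 6(M+1)²`, under an
  agreement implied by `AgreesOnWindow H₀ wd`, IS the windowed contract `KernelSlabSoundF … wd …` of RCZU — the reader's input);
* §15 ★★ `kernelSlabSoundOn_of_blocks` (the sub-window twin of RCXRT `kernelSlabSoundOut_of_blocks`, over ZZZYRCXRVA's generic slab lemmas): a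
  group of accepted blocks run on ANY window `[wlo, whi] ∋ 600 + H₀` with letters `win'` proves the part on its far layers under
  `Agree ℓ := AdmO win' wlo whi (rhoOf ℓ)`;
* §16 ★ `kernelSlabSoundF_of_updown`: the door of record for a full word `win` (`|win| = 2H₀+1`) from an UP group (window `[600+H₀, 600+2H₀]`, upper
  half-word) and a DOWN group (window `[600, 600+H₀]`, lower half-word) with disjoint far layers covering `[600+H₀−M, 600+H₀+M]`.

Imports ZZZYRCXRVA (hence RCXRT); 0 sorry; no new program objects.  All `[folklore]`.
-/

namespace Summit.AtomisticToContinuum.Crystallization.Theorems.ChartedZeroExcessLayeredLatticeLiouville.ThetaKernel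

open scoped BigOperators

/-! ## §13 sub-window admissibility -/

/-- DECIDED: `win'` is the factor of `win` at offset `j` (letter by letter, read with padding `0`). -/
def subWord (win : List ℕ) (j : ℕ) (win' : List ℕ) : Bool :=
  (List.range win'.length).all fun i => Nat.beq (win.getD (j + i) 0) (win'.getD i 0)

/-- soundness of `subWord`. [folklore] -/
theorem getD_of_subWord {win win' : List ℕ} {j : ℕ} (h : subWord win j win' = true) {i : ℕ} (hi : i < win'.length) :
    win.getD (j + i) 0 = win'.getD i 0 := by
  unfold subWord at h
  simpa using List.all_eq_true.mp h i (List.mem_range.mpr hi)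

/-- ★ SUB-WINDOWS ONLY FREE LETTERS: an assignment admissible for the window `[wlo, whi]` with letters `win` is admissible for the sub-window
`[wlo + j, whi']` (`whi' ≤ whi`) with the factor `win'` of `win` at offset `j`, provided the factor covers it (`whi' + 1 ≤ wlo + j + |win'|`). [folklore] -/
theorem admO_sub {win win' : List ℕ} {wlo whi j whi' : ℕ} {ρ : ℕ → ℕ} (hρ : AdmO win wlo whi ρ) (hsub : subWord win j win' = true)
    (hlen : whi' + 1 ≤ wlo + j + win'.length) (hwhi : whi' ≤ whi) : AdmO win' (wlo + j) whi' ρ := by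
  refine ⟨fun am ham => ?_, hρ.2⟩
  unfold inWin at ham
  rw [Bool.and_eq_true, Nat.ble_eq, Nat.ble_eq] at ham
  have hin : inWin wlo whi am = true := by
    unfold inWin; rw [Bool.and_eq_true, Nat.ble_eq, Nat.ble_eq]; omega
  rw [hρ.1 am hin, show am - wlo = j + (am - (wlo + j)) by omega]
  exact getD_of_subWord hsub (by omega)

/-- the instance of record: a letter sequence agreeing with the full window word (`|win| = 2H₀ + 1`) is admissible for every sub-window run
`[600 + j, whi']` on a covering factor. [folklore] -/
theorem admO_rhoOf_sub {ℓ : ℤ → ℤ} (hℓ : IsLetterSeq ℓ) {H₀ j whi' : ℕ} {win win' : List ℕ} (hwl : win.length = 2 * H₀ + 1)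
    (hag : AgreesOnWindow H₀ (wordZ win) ℓ) (hsub : subWord win j win' = true) (hlen : whi' + 1 ≤ 600 + j + win'.length)
    (hwhi : whi' ≤ 600 + 2 * H₀) : AdmO win' (600 + j) whi' (rhoOf ℓ) :=
  admO_sub (admO_rhoOf hℓ hwl hag) hsub hlen hwhi

/-! ## §14 the partial contract on a list of far layers -/

/-- ★ **THE PARTIAL WINDOWED CONTRACT ON THE FAR LAYERS `yms`** (shifted layer codes, far layer `m = ym − 600` in window coordinates) under the
agreement predicate `Agree` on letter sequences: for every letter sequence `ℓ` (RCZO `IsLetterSeq`) with `Agree ℓ` — every datum is centre-based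
with far layer in `yms` and path within `R` layers of the centre, piece bounds `0 < n9F ℓ ≤ P9max` whenever the chord is in range under `ℓ`, no
duplicate pairs, EVERY centre-based pair with far layer in `yms` in range under `ℓ` has a datum, and the guarded tables are majorised at dyadic
exponent `E`.  `Agree := AgreesOnWindow H₀ wd` and `yms ⊇` all layers within reach give RCZU's `KernelSlabSoundF` (`kernelSlabSoundF_of_on`). [g101] -/
def KernelSlabSoundOn (H₀ R : ℕ) (Agree : (ℤ → ℤ) → Prop) (yms : List ℕ) (lo hi P9max : ℤ) (E : ℕ) (cd : List ChordDatum)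
    (TRz TNz : ℤ × ℤ × ℤ × ℤ → ℤ) : Prop :=
  ∀ ℓ : ℤ → ℤ, IsLetterSeq ℓ → Agree ℓ →
    (∀ c ∈ cd, IsCenterBased H₀ c.1 ∧ (∃ ym ∈ yms, c.1.2.2 = (ym : ℤ) - 600) ∧ PiecesWithin H₀ R c ∧
        (lo < n9F ℓ c.1 → n9F ℓ c.1 ≤ hi → ∀ i < chordNp c, 0 < n9F ℓ (chordPiece c i) ∧ n9F ℓ (chordPiece c i) ≤ P9max)) ∧
      (cd.map (·.1)).Nodup ∧
      (∀ x : (Cell 2 × ℤ) × (Cell 2 × ℤ), IsCenterBased H₀ x → (∃ ym ∈ yms, x.2.2 = (ym : ℤ) - 600) → lo < n9F ℓ x → n9F ℓ x ≤ hi →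
        ∃ c ∈ cd, c.1 = x) ∧
      ∀ k, thetaR0G ℓ lo hi cd k ≤ (TRz k : ℝ) / 2 ^ E ∧ thetaN0G ℓ lo hi cd k ≤ (TNz k : ℝ) / 2 ^ E

section Contract

variable {H₀ R E : ℕ} {lo hi P9max : ℤ}

/-- a WEAKER agreement hypothesis gives a STRONGER part: parts are contravariant in `Agree`. [folklore] -/
theorem kernelSlabSoundOn_mono {A A' : (ℤ → ℤ) → Prop} {yms : List ℕ} {cd : List ChordDatum} {TRz TNz : ℤ × ℤ × ℤ × ℤ → ℤ}
    (hA : ∀ ℓ, IsLetterSeq ℓ → A' ℓ → A ℓ) (h : KernelSlabSoundOn H₀ R A yms lo hi P9max E cd TRz TNz) :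
    KernelSlabSoundOn H₀ R A' yms lo hi P9max E cd TRz TNz := fun ℓ hℓ ha => h ℓ hℓ (hA ℓ hℓ ha)

/-- ★ **UNION**: two parts on DISJOINT far-layer lists join to the part on the concatenated list under the conjunction of the agreements, with
concatenated data and added tables (distinctness across the parts: the far layers differ). [folklore] -/
theorem kernelSlabSoundOn_append {A₁ A₂ : (ℤ → ℤ) → Prop} {yms₁ yms₂ : List ℕ} {cd₁ cd₂ : List ChordDatum}
    {TR₁ TN₁ TR₂ TN₂ : ℤ × ℤ × ℤ × ℤ → ℤ} (h₁ : KernelSlabSoundOn H₀ R A₁ yms₁ lo hi P9max E cd₁ TR₁ TN₁)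
    (h₂ : KernelSlabSoundOn H₀ R A₂ yms₂ lo hi P9max E cd₂ TR₂ TN₂) (hdis : ∀ ym ∈ yms₁, ym ∉ yms₂) :
    KernelSlabSoundOn H₀ R (fun ℓ => A₁ ℓ ∧ A₂ ℓ) (yms₁ ++ yms₂) lo hi P9max E (cd₁ ++ cd₂) (fun k => TR₁ k + TR₂ k)
      fun k => TN₁ k + TN₂ k := by
  intro ℓ hℓ ha
  obtain ⟨V₁, N₁, C₁, T₁⟩ := h₁ ℓ hℓ ha.1
  obtain ⟨V₂, N₂, C₂, T₂⟩ := h₂ ℓ hℓ ha.2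
  refine ⟨fun c hc => ?_, ?_, fun x hxb hfar hxlo hxhi => ?_, fun k => ?_⟩
  · rcases List.mem_append.mp hc with hc | hc
    · obtain ⟨h1, ⟨ym, hym, hy⟩, h3, h4⟩ := V₁ c hc
      exact ⟨h1, ⟨ym, List.mem_append_left _ hym, hy⟩, h3, h4⟩
    · obtain ⟨h1, ⟨ym, hym, hy⟩, h3, h4⟩ := V₂ c hc
      exact ⟨h1, ⟨ym, List.mem_append_right _ hym, hy⟩, h3, h4⟩
  · rw [List.map_append]
    refine List.nodup_append.mpr ⟨N₁, N₂, fun p hp q hq hpq => ?_⟩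
    obtain ⟨c₁, hc₁, rfl⟩ := List.mem_map.mp hp
    obtain ⟨c₂, hc₂, rfl⟩ := List.mem_map.mp hq
    obtain ⟨ym₁, hym₁, e₁⟩ := (V₁ c₁ hc₁).2.1
    obtain ⟨ym₂, hym₂, e₂⟩ := (V₂ c₂ hc₂).2.1
    have h12 : c₁.1.2.2 = c₂.1.2.2 := by rw [hpq]
    have hyy : ym₁ = ym₂ := by
      have : (ym₁ : ℤ) = ym₂ := by linarith [h12, e₁, e₂]
      exact_mod_cast this
    exact hdis ym₁ hym₁ (hyy ▸ hym₂)
  · obtain ⟨ym, hym, hy⟩ := hfar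
    rcases List.mem_append.mp hym with h | h
    · obtain ⟨c, hc, hcx⟩ := C₁ x hxb ⟨ym, h, hy⟩ hxlo hxhi
      exact ⟨c, List.mem_append_left _ hc, hcx⟩
    · obtain ⟨c, hc, hcx⟩ := C₂ x hxb ⟨ym, h, hy⟩ hxlo hxhi
      exact ⟨c, List.mem_append_right _ hc, hcx⟩
  · obtain ⟨eR, eN⟩ := thetaG_append ℓ lo hi cd₁ cd₂ k
    rw [eR, eN, Int.cast_add, Int.cast_add, add_div, add_div]
    exact ⟨add_le_add (T₁ k).1 (T₂ k).1, add_le_add (T₁ k).2 (T₂ k).2⟩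

/-- DECIDED COVERAGE: every shifted layer within `M` of the centre `600 + H₀` is a block of `yms` (no letter window exempted: production has no
periodic in-program any more, critic r1907 (B1)). -/
def coverAll (H₀ M : ℕ) (yms : List ℕ) : Bool := (List.range (2 * M + 1)).all fun i => yms.elem (600 + H₀ + i - M)

/-- soundness of `coverAll`. [folklore] -/
theorem mem_of_coverAll {M : ℕ} {yms : List ℕ} (h : coverAll H₀ M yms = true) (hM : M ≤ 600 + H₀) {ym : ℕ} (h1 : 600 + H₀ ≤ ym + M)
    (h2 : ym ≤ 600 + H₀ + M) : ym ∈ yms := by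
  unfold coverAll at h
  have hi := List.all_eq_true.mp h (ym + M - (600 + H₀)) (List.mem_range.mpr (by omega))
  have he : 600 + H₀ + (ym + M - (600 + H₀)) - M = ym := by omega
  rw [he] at hi
  exact List.elem_iff.mp hi

/-- ★ **A COVERING PART IS THE WINDOWED CONTRACT**: a part on a block list covering every layer within `M` of the centre (`hi < 6(M+1)²`,
`4hi < 3(3GB+1)²`), under an agreement implied by `AgreesOnWindow H₀ wd`, is RCZU's `KernelSlabSoundF H₀ R wd …` — the input of the reader of
record (RCZW `windowDataF_of_kernel`, RCZY). [folklore] -/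
theorem kernelSlabSoundF_of_on {M GB : ℕ} {wd : List ℤ} {A : (ℤ → ℤ) → Prop} {yms : List ℕ} {cd : List ChordDatum}
    {TRz TNz : ℤ × ℤ × ℤ × ℤ → ℤ} (hA : ∀ ℓ, IsLetterSeq ℓ → AgreesOnWindow H₀ wd ℓ → A ℓ)
    (hGB : 4 * hi < 3 * (3 * (GB : ℤ) + 1) ^ 2) (hMb : hi < 6 * ((M : ℤ) + 1) ^ 2) (hM : M ≤ 600 + H₀) (hcov : coverAll H₀ M yms = true)
    (h : KernelSlabSoundOn H₀ R A yms lo hi P9max E cd TRz TNz) : KernelSlabSoundF H₀ R wd lo hi P9max E cd TRz TNz := by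
  intro ℓ hℓ hag
  obtain ⟨V, N, C, T⟩ := h ℓ hℓ (hA ℓ hℓ hag)
  refine ⟨⟨fun c hc => ⟨(V c hc).1, (V c hc).2.2.1, (V c hc).2.2.2⟩, N, fun x hxb hxlo hxhi => C x hxb ?_ hxlo hxhi⟩, T⟩
  obtain ⟨⟨γX, mX⟩, y⟩ := x
  obtain ⟨hγ, hm⟩ := hxb
  simp only at hγ hm
  subst hγ; subst hm
  have hℓy := hℓ y.2
  have hℓc := hℓ (H₀ : ℤ)
  have hd : |ℓ y.2 - ℓ H₀| ≤ 2 := by rw [abs_le]; omega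
  have hhi' := hxhi
  rw [n9F_centre] at hhi'
  obtain ⟨-, -, hgm⟩ := inBox_of_n9_le (y.1 0) (y.1 1) (y.2 - H₀) _ hi GB M hd hhi' hGB hMb
  rw [abs_le] at hgm
  refine ⟨(y.2 + 600).toNat, mem_of_coverAll hcov hM (by omega) (by omega), ?_⟩
  simp only
  omega

end Contract

/-! ## §15 a group of sub-window blocks -/

section SubBlocks

variable {win' : List ℕ} {wlo whi H₀ R P9 E GB M lo hi : ℕ} {yms : List ℕ} {t0 : ℕ → PT} {cs : ℕ → List (List ℕ)}
  {T : ℕ → List (ℕ × ℕ × ℕ)}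

/-- ★★★ **A GROUP OF SUB-WINDOW BLOCKS PROVES THE PART ON ITS FAR LAYERS.**  Window `[wlo, whi] ∋ 600 + H₀` with letters `win'` (all `≤ 2`),
path radius `R`, near window `(lo, hi]` with `4·hi < 3(3GB+1)²`, `hi < 6(M+1)²`; blocks `ym ∈ yms` (distinct), each an ACCEPTED slab run on
THAT window with strictly increasing far codes, exactly `countWinsO win' wlo whi (600+H₀) GB lo hi ym` chords, far layer `ym`, every node within
`R` of the centre, nonempty chords.  Conclusion: the part `KernelSlabSoundOn` on `yms` under `Agree ℓ := AdmO win' wlo whi (rhoOf ℓ)` — i.e. for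
EVERY letter sequence agreeing with `win'` on the sub-window, whatever its other letters (RCXRT `kernelSlabSoundOut_of_blocks` is the case
`[wlo, whi] = [600, 600 + 2H₀]` restricted to out-of-window far layers). [folklore] -/
theorem kernelSlabSoundOn_of_blocks (hw2 : ∀ n ∈ win', n ≤ 2) (hX : inWin wlo whi (600 + H₀) = true) (hH : H₀ < 601)
    (hP9 : P9 ≤ 2000000) (hGB6 : GB ≤ 600) (hGB : 4 * hi < 3 * (3 * GB + 1) ^ 2) (hMb : hi < 6 * (M + 1) ^ 2) (hnd : yms.Nodup)
    (hblk : ∀ ym ∈ yms, slabAccO win' wlo whi (600 + H₀) P9 E (lo : ℤ) (hi : ℤ) (t0 ym) (cs ym) = some (T ym) ∧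
      lastCodesStrict (cs ym) = true ∧ (cs ym).length = countWinsO win' wlo whi (600 + H₀) GB lo hi ym ∧
      farLayer ym (cs ym) = true ∧ nodesWithin H₀ R (cs ym) = true ∧ nonemptyAll (cs ym) = true) :
    KernelSlabSoundOn H₀ R (fun ℓ => AdmO win' wlo whi (rhoOf ℓ)) yms lo hi P9 E (outData H₀ yms cs) (outTR yms T) (outTN yms T) := by
  intro ℓ hℓ hρ
  have hGBz : 4 * (hi : ℤ) < 3 * (3 * (GB : ℤ) + 1) ^ 2 := by exact_mod_cast hGB
  have hMBz : (hi : ℤ) < 6 * ((M : ℤ) + 1) ^ 2 := by exact_mod_cast hMb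
  have hmem : ∀ c' ∈ outData H₀ yms cs, ∃ ym ∈ yms, ∃ c ∈ cs ym, c' = decodeChord H₀ c := by
    intro c' hc'
    unfold outData at hc'
    obtain ⟨ym, hym, hc'⟩ := List.mem_flatMap.mp hc'
    obtain ⟨c, hc, rfl⟩ := List.mem_map.mp hc'
    exact ⟨ym, hym, c, hc, rfl⟩
  have hfar : ∀ ym ∈ yms, ∀ c ∈ cs ym, (decodeChord H₀ c).1.2.2 = (ym : ℤ) - 600 := by
    intro ym hym c hc
    have h := farLayer_sound (hblk ym hym).2.2.2.1 c hc
    have hY : (decodeChord H₀ c).1.2.2 = ((lastD c 0 % 1201 : ℕ) : ℤ) - 600 := rfl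
    rw [hY, h]
  refine ⟨fun c' hc' => ?_, ?_, fun x hxb hxf hxlo hxhi => ?_, fun k => ?_⟩
  · -- validity
    obtain ⟨ym, hym, c, hc, rfl⟩ := hmem c' hc'
    obtain ⟨hacc, -, -, -, hnw, hna⟩ := hblk ym hym
    have hne := ne_nil_of_nonemptyAll hna
    obtain ⟨hcb, hpc⟩ := slab_validO' hℓ hρ hX hH hne hacc (decodeChord H₀ c) (List.mem_map.mpr ⟨c, hc, rfl⟩)
    exact ⟨hcb, ⟨ym, hym, hfar ym hym c hc⟩, piecesWithin_of_nodesWithin hne hnw c hc, hpc⟩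
  · -- distinctness
    unfold outData
    rw [List.map_flatMap]
    refine List.nodup_flatMap.mpr ⟨fun ym hym => ?_, ?_⟩
    · have hs := slab_nodup (mX := H₀) (hblk ym hym).2.1
      simpa [List.map_map] using hs
    · refine List.Pairwise.imp_of_mem (R := (· ≠ ·)) ?_ hnd
      intro ym ym' hym hym' hne q hq hq'
      simp only at hq hq'
      obtain ⟨c', hc', hcq⟩ := List.mem_map.mp hq
      obtain ⟨c'', hc'', hcq'⟩ := List.mem_map.mp hq'
      obtain ⟨d, hd, rfl⟩ := List.mem_map.mp hc'
      obtain ⟨d', hd', rfl⟩ := List.mem_map.mp hc''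
      have h1 := hfar ym hym d hd
      have h2 := hfar ym' hym' d' hd'
      rw [hcq] at h1
      rw [hcq'] at h2
      exact hne (by exact_mod_cast (show (ym : ℤ) = ym' by linarith))
  · -- completeness on the far layers of the group
    obtain ⟨⟨γX, mX⟩, y⟩ := x
    obtain ⟨hγ, hm⟩ := hxb
    obtain ⟨ym, hymem, hy⟩ := hxf
    simp only at hγ hm hy hxlo hxhi
    subst hγ; subst hm
    have hℓy := hℓ y.2
    have hℓc := hℓ (H₀ : ℤ)
    have hd : |ℓ y.2 - ℓ H₀| ≤ 2 := by rw [abs_le]; omega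
    rw [n9F_centre] at hxlo hxhi
    obtain ⟨hg0, hg1, -⟩ := inBox_of_n9_le (y.1 0) (y.1 1) (y.2 - H₀) _ (hi : ℤ) GB M hd hxhi hGBz hMBz
    rw [abs_le] at hg0 hg1
    set y0 := (y.1 0 + 600).toNat with hy0
    set y1 := (y.1 1 + 600).toNat with hy1
    have e0 : (y0 : ℤ) = y.1 0 + 600 := by rw [hy0]; omega
    have e1 : (y1 : ℤ) = y.1 1 + 600 := by rw [hy1]; omega
    have em : (ym : ℤ) = y.2 + 600 := by omega
    have hsite : siteN (y0, y1, ym) = y := by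
      have := siteN_shift (y := y) (by omega) (by omega) (by omega)
      rwa [show (y.2 + 600).toNat = ym by omega] at this
    have hlift : liftN (chordX H₀, (y0, y1, ym)) = (((0 : Cell 2), (H₀ : ℤ)), y) := by rw [liftN, siteN_chordX, hsite]
    obtain ⟨hacc, hstrict, hcount, hfl, -, -⟩ := hblk ym hymem
    have hform : n9F ℓ (((0 : Cell 2), (H₀ : ℤ)), y) = n9Z (vecL (rhoOf ℓ) (chordXO (600 + H₀), (y0, y1, ym))) := by
      rw [chordXO_eq, ← hlift, n9F_liftN_rho hℓ]
    rw [← n9F_centre, hform] at hxlo hxhi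
    obtain ⟨c, hc, hdec⟩ := outBlock_complete hw2 hX (by omega) hGBz hacc hstrict hfl hcount hρ hxlo hxhi
    refine ⟨decodeChord H₀ c, ?_, ?_⟩
    · unfold outData
      exact List.mem_flatMap.mpr ⟨ym, hymem, List.mem_map.mpr ⟨c, hc, rfl⟩⟩
    · rw [decodeChord_fst, hdec, hlift]
  · -- tables
    exact thetaG_outData_le' hℓ hρ hX hH hP9 (fun ym hym => ⟨(hblk ym hym).1, (hblk ym hym).2.2.2.2.2⟩) yms (fun _ h => h) k

end SubBlocks

/-! ## §16 the door for a full word from an UP group and a DOWN group -/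

/-- ★★ **THE HALF-WORD DOOR** (critic r1907 (B1)): for a full window word `win` (`|win| = 2H₀ + 1`), an UP part (run on the window
`[600 + H₀, 600 + 2H₀]` with the upper half-word `u = win[H₀ …]`) on the far layers `ymsU` and a DOWN part (run on `[600, 600 + H₀]` with the
lower half-word `v = win[… H₀]`) on `ymsD`, with `ymsU`, `ymsD` disjoint and together covering every layer within `M` of the centre, give RCZU's
windowed contract for `win` on the concatenated data with the added tables. [folklore] -/
theorem kernelSlabSoundF_of_updown {win u v : List ℕ} {H₀ R E GB M : ℕ} {lo hi P9max : ℤ} {ymsU ymsD : List ℕ} {cdU cdD : List ChordDatum}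
    {TRU TNU TRD TND : ℤ × ℤ × ℤ × ℤ → ℤ} (hwl : win.length = 2 * H₀ + 1) (hu : subWord win H₀ u = true) (hul : u.length = H₀ + 1)
    (hv : subWord win 0 v = true) (hvl : v.length = H₀ + 1)
    (hU : KernelSlabSoundOn H₀ R (fun ℓ => AdmO u (600 + H₀) (600 + 2 * H₀) (rhoOf ℓ)) ymsU lo hi P9max E cdU TRU TNU)
    (hD : KernelSlabSoundOn H₀ R (fun ℓ => AdmO v 600 (600 + H₀) (rhoOf ℓ)) ymsD lo hi P9max E cdD TRD TND)
    (hdis : ∀ ym ∈ ymsU, ym ∉ ymsD) (hGB : 4 * hi < 3 * (3 * (GB : ℤ) + 1) ^ 2) (hMb : hi < 6 * ((M : ℤ) + 1) ^ 2) (hM : M ≤ 600 + H₀)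
    (hcov : coverAll H₀ M (ymsU ++ ymsD) = true) :
    KernelSlabSoundF H₀ R (wordZ win) lo hi P9max E (cdU ++ cdD) (fun k => TRU k + TRD k) fun k => TNU k + TND k := by
  refine kernelSlabSoundF_of_on (fun ℓ hℓ hag => ⟨?_, ?_⟩) hGB hMb hM hcov (kernelSlabSoundOn_append hU hD hdis)
  · exact admO_rhoOf_sub hℓ hwl hag hu (by omega) le_rfl
  · have h := admO_rhoOf_sub (j := 0) (whi' := 600 + H₀) hℓ hwl hag hv (by omega) (by omega)
    simpa using h

/-- TOYS at hand-1's literals (H₀ = 5, word type `20120120120`): the half-words are factors at offsets 5 and 0, both half-windows contain the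
centre code 605, and five blocks cover the layers within 2 of the centre — all by `decide`. [g101] -/
example : subWord [2, 0, 1, 2, 0, 1, 2, 0, 1, 2, 0] 5 [1, 2, 0, 1, 2, 0] = true ∧ subWord [2, 0, 1, 2, 0, 1, 2, 0, 1, 2, 0] 0 [2, 0, 1, 2, 0, 1] = true ∧
    inWin 605 610 605 = true ∧ inWin 600 605 605 = true ∧ coverAll 5 2 ([605, 606, 607] ++ [603, 604]) = true := by decide

end Summit.AtomisticToContinuum.Crystallization.Theorems.ChartedZeroExcessLayeredLatticeLiouville.ThetaKernel
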